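import Mathlib
import Literature.NumberTheory.Sieve.MaynardSimplexIntegrals
import HarnessLib

/-!
# Periodizing variable transformations of the unit interval

[cite: Sidi2003, Sect. 25.1.2]
[cite: DavisRabinowitz1984, Sect. 2.9.2 (2.9.2.1)-(2.9.2.2)]

A *variable transformation* `x = ψ(t)` of `[0, 1]` onto itself with `ψ(0) = 0`, `ψ(1) = 1`,
`ψ' ≥ 0` turns `∫₀¹ f(x) dx` into `∫₀¹ ψ'(t) f(ψ(t)) dt`; when `ψ'` vanishes (to some order) at
both endpoints the new integrand is "periodized" and the trapezoidal rule / a lattice rule applied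
to it gains the accuracy of the Euler–Maclaurin expansion (Sidi 2003, Sect. 25.1.2, properties
(a)–(c); Davis–Rabinowitz 1984, Sect. 2.9.2).  The standard construction (IMT, Korobov, Sidi) is
the *normalised primitive of a weight* `φ > 0` on `(0, 1)`:

  `ψ(t) = (∫₀ᵗ φ(u) du) / (∫₀¹ φ(u) du)`   (Davis–Rabinowitz (2.9.2.1); Sidi items 1, 3, 5),

for which `∫₀¹ f = K⁻¹ ∫₀¹ φ(t) f(ψ(t)) dt`, `K = ∫₀¹ φ` (Davis–Rabinowitz (2.9.2.2), the identity
behind the IMT rule).  This file proves that identity **without any hypothesis on `f`** (Lean's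
`∫` returns `0` on both sides when the integrands are not integrable, and integrability transfers
along a monotone `C¹` substitution), for a general weight (`weightTransform`,
`integral_weightTransform_substitution`) and for the three classical families:

* the **Korobov transformation** `φ(u) = (u(1-u))^m` (Sidi item 1, Korobov 1963), with its
  normaliser `K = (m!)²/(2m+1)!` (`korobov_normalizer`) and the explicit polynomial maps for
  `m = 1, 2, 3`: `3t² − 2t³`, `10t³ − 15t⁴ + 6t⁵`, `35t⁴ − 84t⁵ + 70t⁶ − 20t⁷`;
* **Sidi's `sinᵐ`-transformation** `φ(u) = sin(πu)^m` (Sidi item 5), with the explicit maps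
  `ψ₁(t) = sin²(πt/2)`, `ψ₂(t) = t − sin(2πt)/(2π)`, `ψ₃(t) = sin²(πt/2) − ¼ sin²(πt) cos(πt)`
  of Sidi's recursion;
* the **IMT transformation** of Iri–Moriguti–Takasawa, `φ(t) = exp(−a t⁻ᵖ − b (1−t)^{-q})`
  (Davis–Rabinowitz (2.9.2.1); Sidi item 3 is `a = b = c`, `p = q = 1`).

The monotone change of variables itself is Mathlib's
`intervalIntegral.integral_comp_mul_deriv_of_deriv_nonneg`; the Beta value `∫₀¹ uᵐ(1−u)ⁿ du` is the
tree's `Literature.NumberTheory.Sieve.MaynardTao.integral_pow_mul_one_sub_pow`.  Neither is restated here.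
The Sag–Szekeres `tanh` map and Mori's double-exponential map (Sidi items 2, 4) are whole-line
constructions treated in `Literature.Analysis.Quadrature.TanhSinhTransformation` and
`Literature.MeasureTheory.Integral.WholeAxisSubstitution`.
-/

open _root_.MeasureTheory Set intervalIntegral Real

namespace Literature.MeasureTheory.Integral

/-! ### The normalised primitive of a weight -/

/-- The variable transformation generated by a weight `φ`: `ψ(t) = (∫₀ᵗ φ) / (∫₀¹ φ)`.
[cite: DavisRabinowitz1984, Sect. 2.9.2 (2.9.2.1)] -/
noncomputable def weightTransform (φ : ℝ → ℝ) (t : ℝ) : ℝ :=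
  (∫ u in (0:ℝ)..t, φ u) / ∫ u in (0:ℝ)..1, φ u

/-- `ψ(0) = 0` (Sidi 2003, property (a)).
[cite: Sidi2003, Sect. 25.1.2] -/
@[simp] theorem weightTransform_zero (φ : ℝ → ℝ) : weightTransform φ 0 = 0 := by
  simp [weightTransform]

/-- `ψ(1) = 1` (Sidi 2003, property (a)).
[cite: Sidi2003, Sect. 25.1.2] -/
theorem weightTransform_one {φ : ℝ → ℝ} (hK : ∫ u in (0:ℝ)..1, φ u ≠ 0) :
    weightTransform φ 1 = 1 := by
  simp [weightTransform, div_self hK]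

/-- `ψ` is continuous on `[0, 1]` as soon as the weight is integrable there (Sidi 2003, property (a):
`ψ` maps `[0, 1]` to `[0, 1]` continuously).
[cite: Sidi2003, Sect. 25.1.2] -/
theorem continuousOn_weightTransform {φ : ℝ → ℝ} (hφ : IntervalIntegrable φ volume 0 1) :
    ContinuousOn (weightTransform φ) (Icc 0 1) := by
  have h : ContinuousOn (fun t => ∫ u in (0:ℝ)..t, φ u) (uIcc 0 1) :=
    continuousOn_primitive_interval (μ := volume)
      ((intervalIntegrable_iff_integrableOn_Icc_of_le zero_le_one).mp hφ |>.congr_set_ae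
        (by rw [uIcc_of_le zero_le_one]))
  rw [uIcc_of_le zero_le_one] at h
  exact h.div_const _

/-- `ψ'(t) = φ(t)/K` at every interior point where the weight is continuous (FTC).
[cite: DavisRabinowitz1984, Sect. 2.9.2 (2.9.2.1)] -/
theorem hasDerivAt_weightTransform {φ : ℝ → ℝ} (hφ : IntervalIntegrable φ volume 0 1)
    (hcont : ContinuousOn φ (Ioo 0 1)) {t : ℝ} (ht : t ∈ Ioo (0:ℝ) 1) :
    HasDerivAt (weightTransform φ) (φ t / ∫ u in (0:ℝ)..1, φ u) t := by
  have h1 : IntervalIntegrable φ volume 0 t :=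
    hφ.mono_set (by
      rw [uIcc_of_le zero_le_one, uIcc_of_le ht.1.le]
      exact Icc_subset_Icc_right ht.2.le)
  have h := integral_hasDerivAt_right h1 (hcont.stronglyMeasurableAtFilter isOpen_Ioo t ht)
    (hcont.continuousAt (Ioo_mem_nhds ht.1 ht.2))
  exact h.div_const _

/-- Symmetry (Sidi 2003, property (b)): an even weight about `1/2` gives `ψ(1 − t) = 1 − ψ(t)`.
[cite: Sidi2003, Sect. 25.1.2] -/
theorem weightTransform_symm {φ : ℝ → ℝ} (hφ : IntervalIntegrable φ volume 0 1)
    (hsymm : ∀ u, φ (1 - u) = φ u) (hK : ∫ u in (0:ℝ)..1, φ u ≠ 0) {t : ℝ} (ht : t ∈ Icc (0:ℝ) 1) :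
    weightTransform φ (1 - t) = 1 - weightTransform φ t := by
  have h0t : IntervalIntegrable φ volume 0 t :=
    hφ.mono_set (by rw [uIcc_of_le zero_le_one, uIcc_of_le ht.1]; exact Icc_subset_Icc_right ht.2)
  have ht1 : IntervalIntegrable φ volume t 1 :=
    hφ.mono_set (by rw [uIcc_of_le zero_le_one, uIcc_of_le ht.2]; exact Icc_subset_Icc_left ht.1)
  have hsplit : (∫ u in t..(1:ℝ), φ u) + (∫ u in (0:ℝ)..t, φ u) = ∫ u in (0:ℝ)..1, φ u := by
    rw [add_comm]; exact integral_add_adjacent_intervals h0t ht1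
  have hrefl : ∫ u in (0:ℝ)..1 - t, φ u = ∫ u in t..(1:ℝ), φ u := by
    have h := intervalIntegral.integral_comp_sub_left (fun u => φ u) (1:ℝ) (a := t) (b := 1)
    simp only [hsymm, sub_self] at h
    exact h.symm
  rw [weightTransform, weightTransform, hrefl, eq_sub_iff_add_eq, ← add_div, hsplit, div_self hK]

/-- **The normalised-weight substitution** (the identity behind the IMT rule): for a weight `φ`
integrable on `[0, 1]`, continuous and positive on `(0, 1)`,
`∫₀¹ f(x) dx = K⁻¹ ∫₀¹ φ(t) f(ψ(t)) dt`, `K = ∫₀¹ φ`, with no hypothesis on `f`.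
[cite: DavisRabinowitz1984, Sect. 2.9.2 (2.9.2.2)] -/
theorem integral_weightTransform_substitution {φ : ℝ → ℝ} (hφ : IntervalIntegrable φ volume 0 1)
    (hcont : ContinuousOn φ (Ioo 0 1)) (hpos : ∀ t ∈ Ioo (0:ℝ) 1, 0 < φ t) (f : ℝ → ℝ) :
    ∫ x in (0:ℝ)..1, f x =
      (∫ u in (0:ℝ)..1, φ u)⁻¹ * ∫ t in (0:ℝ)..1, φ t * f (weightTransform φ t) := by
  set K := ∫ u in (0:ℝ)..1, φ u with hK
  have hKpos : 0 < K := intervalIntegral_pos_of_pos_on hφ hpos zero_lt_one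
  have hψ : ContinuousOn (weightTransform φ) (uIcc 0 1) := by
    rw [uIcc_of_le zero_le_one]; exact continuousOn_weightTransform hφ
  have hder : ∀ t ∈ Ioo (min (0:ℝ) 1) (max (0:ℝ) 1),
      HasDerivAt (weightTransform φ) (φ t / K) t := by
    intro t ht
    rw [min_eq_left zero_le_one, max_eq_right zero_le_one] at ht
    exact hasDerivAt_weightTransform hφ hcont ht
  have hnn : ∀ t ∈ Ioo (min (0:ℝ) 1) (max (0:ℝ) 1), 0 ≤ φ t / K := by
    intro t ht
    rw [min_eq_left zero_le_one, max_eq_right zero_le_one] at ht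
    exact div_nonneg (hpos t ht).le hKpos.le
  have h := integral_comp_mul_deriv_of_deriv_nonneg (g := f) hψ hder hnn
  rw [weightTransform_zero, weightTransform_one hKpos.ne'] at h
  rw [← h, ← intervalIntegral.integral_const_mul]
  refine intervalIntegral.integral_congr fun t _ => ?_
  simp only [Function.comp_apply]
  field_simp

/-! ### The Korobov transformation -/

/-- The Korobov normaliser: `∫₀¹ (u(1−u))ᵐ du = (m!)²/(2m+1)!`, so that Sidi's constant
`(2m+1) binom(2m, m)` is its reciprocal.
[cite: Sidi2003, Sect. 25.1.2] -/
theorem korobov_normalizer (m : ℕ) :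
    ∫ u in (0:ℝ)..1, (u * (1 - u)) ^ m = (m.factorial * m.factorial : ℝ) / (2 * m + 1).factorial := by
  simp only [mul_pow]
  rw [Literature.NumberTheory.Sieve.MaynardTao.integral_pow_mul_one_sub_pow m m, two_mul]

/-- **Korobov's transformation** (general order `m`): with `ψₘ = weightTransform (u ↦ (u(1−u))ᵐ)`,
`∫₀¹ f = ((2m+1)!/(m!)²) ∫₀¹ (t(1−t))ᵐ f(ψₘ(t)) dt`, hypothesis-free in `f`.
[cite: Sidi2003, Sect. 25.1.2] -/
theorem integral_korobov_substitution (m : ℕ) (f : ℝ → ℝ) :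
    ∫ x in (0:ℝ)..1, f x = ((2 * m + 1).factorial : ℝ) / (m.factorial * m.factorial) *
      ∫ t in (0:ℝ)..1, (t * (1 - t)) ^ m * f (weightTransform (fun u => (u * (1 - u)) ^ m) t) := by
  have h := integral_weightTransform_substitution (φ := fun u => (u * (1 - u)) ^ m)
    (by apply Continuous.intervalIntegrable; fun_prop) (by fun_prop)
    (fun t ht => by have := ht.1; have := ht.2; positivity) f
  rw [h, korobov_normalizer, inv_div]

/-- Korobov, `m = 1`: `ψ(t) = 3t² − 2t³`, `ψ'(t) = 6t(1−t)`.
[cite: Sidi2003, Sect. 25.1.2] -/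
theorem integral_korobov_one_substitution (f : ℝ → ℝ) :
    ∫ x in (0:ℝ)..1, f x = ∫ t in (0:ℝ)..1, 6 * t * (1 - t) * f (3 * t ^ 2 - 2 * t ^ 3) := by
  have h := integral_comp_mul_deriv_of_deriv_nonneg (a := 0) (b := 1)
    (f := fun t : ℝ => 3 * t ^ 2 - 2 * t ^ 3) (f' := fun t => 6 * t * (1 - t)) (g := f)
    (by fun_prop)
    (fun t _ => (((hasDerivAt_pow 2 t).const_mul 3).sub ((hasDerivAt_pow 3 t).const_mul 2)).congr_deriv
      (by simp; ring))
    (fun t ht => by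
      rw [min_eq_left zero_le_one, max_eq_right zero_le_one] at ht
      have := ht.1; have : 0 ≤ 1 - t := by linarith [ht.2]
      positivity)
  norm_num at h
  rw [← h]
  refine intervalIntegral.integral_congr fun t _ => ?_
  try simp only [Function.comp_apply]
  ring

/-- Korobov, `m = 2`: `ψ(t) = 10t³ − 15t⁴ + 6t⁵`, `ψ'(t) = 30t²(1−t)²`.
[cite: Sidi2003, Sect. 25.1.2] -/
theorem integral_korobov_two_substitution (f : ℝ → ℝ) :
    ∫ x in (0:ℝ)..1, f x =
      ∫ t in (0:ℝ)..1, 30 * t ^ 2 * (1 - t) ^ 2 * f (10 * t ^ 3 - 15 * t ^ 4 + 6 * t ^ 5) := by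
  have h := integral_comp_mul_deriv_of_deriv_nonneg (a := 0) (b := 1)
    (f := fun t : ℝ => 10 * t ^ 3 - 15 * t ^ 4 + 6 * t ^ 5) (f' := fun t => 30 * t ^ 2 * (1 - t) ^ 2)
    (g := f) (by fun_prop)
    (fun t _ => ((((hasDerivAt_pow 3 t).const_mul 10).sub ((hasDerivAt_pow 4 t).const_mul 15)).add
      ((hasDerivAt_pow 5 t).const_mul 6)).congr_deriv (by simp; ring))
    (fun t _ => by positivity)
  norm_num at h
  rw [← h]
  refine intervalIntegral.integral_congr fun t _ => ?_
  try simp only [Function.comp_apply]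
  ring

/-- Korobov, `m = 3`: `ψ(t) = 35t⁴ − 84t⁵ + 70t⁶ − 20t⁷`, `ψ'(t) = 140t³(1−t)³`.
[cite: Sidi2003, Sect. 25.1.2] -/
theorem integral_korobov_three_substitution (f : ℝ → ℝ) :
    ∫ x in (0:ℝ)..1, f x = ∫ t in (0:ℝ)..1,
      140 * t ^ 3 * (1 - t) ^ 3 * f (35 * t ^ 4 - 84 * t ^ 5 + 70 * t ^ 6 - 20 * t ^ 7) := by
  have h := integral_comp_mul_deriv_of_deriv_nonneg (a := 0) (b := 1)
    (f := fun t : ℝ => 35 * t ^ 4 - 84 * t ^ 5 + 70 * t ^ 6 - 20 * t ^ 7)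
    (f' := fun t => 140 * t ^ 3 * (1 - t) ^ 3) (g := f) (by fun_prop)
    (fun t _ => (((((hasDerivAt_pow 4 t).const_mul 35).sub ((hasDerivAt_pow 5 t).const_mul 84)).add
      ((hasDerivAt_pow 6 t).const_mul 70)).sub ((hasDerivAt_pow 7 t).const_mul 20)).congr_deriv
      (by simp; ring))
    (fun t ht => by
      rw [min_eq_left zero_le_one, max_eq_right zero_le_one] at ht
      have := ht.1; have : 0 ≤ 1 - t := by linarith [ht.2]
      positivity)
  norm_num at h
  rw [← h]
  refine intervalIntegral.integral_congr fun t _ => ?_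
  try simp only [Function.comp_apply]
  ring

/-- The Korobov maps are symmetric: `ψ(1−t) = 1 − ψ(t)` (`m = 1`; Sidi property (b)).
[cite: Sidi2003, Sect. 25.1.2] -/
theorem korobov_one_symm (t : ℝ) :
    3 * (1 - t) ^ 2 - 2 * (1 - t) ^ 3 = 1 - (3 * t ^ 2 - 2 * t ^ 3) := by ring

/-! ### Sidi's `sinᵐ`-transformation -/

/-- **Sidi's `sinᵐ`-transformation** (general order `m`): with
`ψₘ = weightTransform (u ↦ sin(πu)ᵐ)`, `∫₀¹ f = (∫₀¹ sin(πu)ᵐ du)⁻¹ ∫₀¹ sin(πt)ᵐ f(ψₘ(t)) dt`,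
hypothesis-free in `f`.
[cite: Sidi2003, Sect. 25.1.2] -/
theorem integral_sinPow_substitution (m : ℕ) (f : ℝ → ℝ) :
    ∫ x in (0:ℝ)..1, f x = (∫ u in (0:ℝ)..1, sin (π * u) ^ m)⁻¹ *
      ∫ t in (0:ℝ)..1, sin (π * t) ^ m * f (weightTransform (fun u => sin (π * u) ^ m) t) :=
  integral_weightTransform_substitution (φ := fun u => sin (π * u) ^ m)
    (by apply Continuous.intervalIntegrable; fun_prop) (by fun_prop)
    (fun t ht => pow_pos (sin_pos_of_pos_of_lt_pi (by nlinarith [pi_pos, ht.1])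
      (by nlinarith [pi_pos, ht.2])) m) f

/-- Sidi's `ψ₁`: `ψ₁(t) = sin²(πt/2)`, `ψ₁'(t) = (π/2) sin(πt)`.
[cite: Sidi2003, Sect. 25.1.2] -/
theorem integral_sin_one_substitution (f : ℝ → ℝ) :
    ∫ x in (0:ℝ)..1, f x = ∫ t in (0:ℝ)..1, π / 2 * sin (π * t) * f (sin (π * t / 2) ^ 2) := by
  have hd : ∀ t : ℝ, HasDerivAt (fun t : ℝ => sin (π * t / 2) ^ 2) (π / 2 * sin (π * t)) t := by
    intro t
    have h1 : HasDerivAt (fun t : ℝ => π * t / 2) (π / 2) t := by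
      simpa using ((hasDerivAt_id t).const_mul π).div_const 2
    have h2 := ((hasDerivAt_sin _).comp t h1).pow 2
    refine h2.congr_deriv ?_
    have : sin (π * t) = 2 * sin (π * t / 2) * cos (π * t / 2) := by
      rw [← sin_two_mul]; ring_nf
    rw [this]; simp; ring
  have h := integral_comp_mul_deriv_of_deriv_nonneg (a := 0) (b := 1)
    (f := fun t : ℝ => sin (π * t / 2) ^ 2) (f' := fun t => π / 2 * sin (π * t)) (g := f)
    (by fun_prop) (fun t _ => hd t)
    (fun t ht => by
      rw [min_eq_left zero_le_one, max_eq_right zero_le_one] at ht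
      have : 0 ≤ sin (π * t) :=
        sin_nonneg_of_nonneg_of_le_pi (by nlinarith [pi_pos, ht.1]) (by nlinarith [pi_pos, ht.2])
      positivity)
  simp only [mul_zero, zero_div, sin_zero, ne_eq, OfNat.ofNat_ne_zero, not_false_eq_true, zero_pow,
    mul_one, sin_pi_div_two, one_pow] at h
  rw [← h]
  refine intervalIntegral.integral_congr fun t _ => ?_
  try simp only [Function.comp_apply]
  ring

/-- Sidi's `ψ₂`: `ψ₂(t) = t − sin(2πt)/(2π)`, `ψ₂'(t) = 1 − cos(2πt) = 2 sin²(πt)`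
("quite effective", Sidi).
[cite: Sidi2003, Sect. 25.1.2] -/
theorem integral_sin_two_substitution (f : ℝ → ℝ) :
    ∫ x in (0:ℝ)..1, f x =
      ∫ t in (0:ℝ)..1, 2 * sin (π * t) ^ 2 * f (t - sin (2 * π * t) / (2 * π)) := by
  have hd : ∀ t : ℝ, HasDerivAt (fun t : ℝ => t - sin (2 * π * t) / (2 * π)) (2 * sin (π * t) ^ 2) t := by
    intro t
    have h1 : HasDerivAt (fun t : ℝ => 2 * π * t) (2 * π) t := by
      simpa using (hasDerivAt_id t).const_mul (2 * π)
    have h2 := (hasDerivAt_id t).sub (((hasDerivAt_sin _).comp t h1).div_const (2 * π))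
    refine h2.congr_deriv ?_
    have hc : cos (2 * π * t) = 1 - 2 * sin (π * t) ^ 2 := by
      rw [show 2 * π * t = 2 * (π * t) by ring, cos_two_mul, cos_sq']; ring
    rw [hc]; field_simp; ring
  have h := integral_comp_mul_deriv_of_deriv_nonneg (a := 0) (b := 1)
    (f := fun t : ℝ => t - sin (2 * π * t) / (2 * π)) (f' := fun t => 2 * sin (π * t) ^ 2) (g := f)
    (by fun_prop) (fun t _ => hd t) (fun t _ => by positivity)
  have h1 : sin (2 * π * 1) = 0 := by rw [mul_one]; exact sin_two_pi
  simp only [mul_zero, sin_zero, zero_div, sub_zero, h1] at h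
  rw [← h]
  refine intervalIntegral.integral_congr fun t _ => ?_
  try simp only [Function.comp_apply]
  ring

/-- Sidi's `ψ₃` (from the recursion `ψ₃ = ψ₁ − Γ(3/2)/(2√π Γ(2)) sin²(πt) cos(πt)`):
`ψ₃(t) = sin²(πt/2) − ¼ sin²(πt) cos(πt)`, `ψ₃'(t) = (3π/4) sin³(πt)`.
[cite: Sidi2003, Sect. 25.1.2] -/
theorem integral_sin_three_substitution (f : ℝ → ℝ) :
    ∫ x in (0:ℝ)..1, f x = ∫ t in (0:ℝ)..1, 3 * π / 4 * sin (π * t) ^ 3 *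
      f (sin (π * t / 2) ^ 2 - 1 / 4 * sin (π * t) ^ 2 * cos (π * t)) := by
  have hd : ∀ t : ℝ, HasDerivAt (fun t : ℝ => sin (π * t / 2) ^ 2 - 1 / 4 * sin (π * t) ^ 2 * cos (π * t))
      (3 * π / 4 * sin (π * t) ^ 3) t := by
    intro t
    have h1 : HasDerivAt (fun t : ℝ => π * t / 2) (π / 2) t := by
      simpa using ((hasDerivAt_id t).const_mul π).div_const 2
    have hπ : HasDerivAt (fun t : ℝ => π * t) π t := by
      simpa using (hasDerivAt_id t).const_mul π
    have h2 := (((hasDerivAt_sin _).comp t h1).pow 2).sub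
      (((((hasDerivAt_sin _).comp t hπ).pow 2).const_mul (1 / 4)).mul ((hasDerivAt_cos _).comp t hπ))
    refine h2.congr_deriv ?_
    have hs : sin (π * t) = 2 * sin (π * t / 2) * cos (π * t / 2) := by
      rw [← sin_two_mul]; ring_nf
    have hs' : 2 * sin (π * t / 2) * cos (π * t / 2) = sin (π * t) := hs.symm
    have hc2 : sin (π * t) ^ 2 + cos (π * t) ^ 2 = 1 := sin_sq_add_cos_sq _
    norm_num
    linear_combination (π / 2) * hs' + (-(π / 2) * sin (π * t)) * hc2
  have h := integral_comp_mul_deriv_of_deriv_nonneg (a := 0) (b := 1)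
    (f := fun t : ℝ => sin (π * t / 2) ^ 2 - 1 / 4 * sin (π * t) ^ 2 * cos (π * t))
    (f' := fun t => 3 * π / 4 * sin (π * t) ^ 3) (g := f)
    (by fun_prop) (fun t _ => hd t)
    (fun t ht => by
      rw [min_eq_left zero_le_one, max_eq_right zero_le_one] at ht
      have : 0 ≤ sin (π * t) :=
        sin_nonneg_of_nonneg_of_le_pi (by nlinarith [pi_pos, ht.1]) (by nlinarith [pi_pos, ht.2])
      positivity)
  simp only [mul_zero, zero_div, sin_zero, ne_eq, OfNat.ofNat_ne_zero, not_false_eq_true, zero_pow,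
    zero_mul, sub_zero, mul_one, sin_pi_div_two, one_pow, sin_pi] at h
  rw [← h]
  refine intervalIntegral.integral_congr fun t _ => ?_
  try simp only [Function.comp_apply]
  ring

/-! ### The IMT transformation -/

/-- The IMT weight of Iri–Moriguti–Takasawa: `φ(t) = exp(−a t⁻ᵖ − b (1−t)^{-q})`.
[cite: DavisRabinowitz1984, Sect. 2.9.2 (2.9.2.1)] -/
noncomputable def imtWeight (a b : ℝ) (p q : ℕ) (t : ℝ) : ℝ :=
  exp (-(a / t ^ p) - b / (1 - t) ^ q)

/-- The IMT weight is positive.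
[cite: DavisRabinowitz1984, Sect. 2.9.2 (2.9.2.1)] -/
theorem imtWeight_pos (a b : ℝ) (p q : ℕ) (t : ℝ) : 0 < imtWeight a b p q t := exp_pos _

/-- On `(0, 1]` (and at the junk point `t = 0`) the IMT weight is at most `1` when `a, b ≥ 0`.
[cite: DavisRabinowitz1984, Sect. 2.9.2 (2.9.2.1)] -/
theorem imtWeight_le_one {a b : ℝ} (ha : 0 ≤ a) (hb : 0 ≤ b) (p q : ℕ) {t : ℝ}
    (ht : t ∈ Icc (0:ℝ) 1) : imtWeight a b p q t ≤ 1 := by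
  rw [imtWeight, exp_le_one_iff]
  have h1 : 0 ≤ a / t ^ p := div_nonneg ha (pow_nonneg ht.1 p)
  have h2 : 0 ≤ b / (1 - t) ^ q := div_nonneg hb (pow_nonneg (by linarith [ht.2]) q)
  linarith

/-- The IMT weight is continuous on the open interval.
[cite: DavisRabinowitz1984, Sect. 2.9.2 (2.9.2.1)] -/
theorem continuousOn_imtWeight (a b : ℝ) (p q : ℕ) :
    ContinuousOn (imtWeight a b p q) (Ioo 0 1) := by
  refine ContinuousOn.rexp (ContinuousOn.sub (ContinuousOn.neg ?_) ?_)
  · exact continuousOn_const.div (by fun_prop) fun t ht => pow_ne_zero p ht.1.ne'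
  · exact continuousOn_const.div (by fun_prop) fun t ht => pow_ne_zero q (by linarith [ht.2])

/-- The IMT weight is integrable on `[0, 1]` (it is measurable and bounded by `1` there), so that
`K = ∫₀¹ φ` of (2.9.2.1) is a genuine integral.
[cite: DavisRabinowitz1984, Sect. 2.9.2 (2.9.2.1)] -/
theorem intervalIntegrable_imtWeight {a b : ℝ} (ha : 0 ≤ a) (hb : 0 ≤ b) (p q : ℕ) :
    IntervalIntegrable (imtWeight a b p q) volume 0 1 := by
  refine (intervalIntegrable_const (c := (1:ℝ))).mono_fun' ?_ ?_
  · exact (by unfold imtWeight; fun_prop : Measurable (imtWeight a b p q)).aestronglyMeasurable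
  · rw [uIoc_of_le zero_le_one]
    refine (ae_restrict_mem measurableSet_Ioc).mono fun t ht => ?_
    show ‖imtWeight a b p q t‖ ≤ 1
    rw [Real.norm_eq_abs, abs_of_pos (imtWeight_pos a b p q t)]
    exact imtWeight_le_one ha hb p q ⟨ht.1.le, ht.2⟩

/-- **The IMT transformation** (Davis–Rabinowitz (2.9.2.1)–(2.9.2.2)): with
`ψ = weightTransform (imtWeight a b p q)` and `K = ∫₀¹ imtWeight a b p q`,
`∫₀¹ f = K⁻¹ ∫₀¹ φ(t) f(ψ(t)) dt`, hypothesis-free in `f`.  Applying the trapezoidal rule to the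
right-hand side gives the IMT rule (2.9.2.3).
[cite: DavisRabinowitz1984, Sect. 2.9.2 (2.9.2.1)-(2.9.2.2)] -/
theorem integral_imt_substitution {a b : ℝ} (ha : 0 ≤ a) (hb : 0 ≤ b) (p q : ℕ) (f : ℝ → ℝ) :
    ∫ x in (0:ℝ)..1, f x = (∫ u in (0:ℝ)..1, imtWeight a b p q u)⁻¹ *
      ∫ t in (0:ℝ)..1, imtWeight a b p q t * f (weightTransform (imtWeight a b p q) t) :=
  integral_weightTransform_substitution (intervalIntegrable_imtWeight ha hb p q)
    (continuousOn_imtWeight a b p q) (fun t _ => imtWeight_pos a b p q t) f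

end Literature.MeasureTheory.Integral
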